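import Mathlib
import HarnessLib
import HarnessLib.Audit
import Summits.CriticalPhenomena.Statement
import Literature.Probability.RandomPlanarGeometry.LoewnerChain
import Literature.Probability.Process.BrownianMotion
import Literature.Probability.RandomPlanarGeometry.ChordalCurveFamily
import HarnessLib.Audit.Status.Attr

/-!
Route: CardyAnchoredRigidity

DORMANT since 2026-08-25T14:49:06Z (reconciler: no traction for 7.8 d (last activity item-evidence-added at 2026-08-17T19:17:51Z); parked, not closed — `ledger route dormant route-CriticalPhenomena-CardyAnchoredRigidity --off` to reacti) — unstaffed, not closed; items shared with open routes are served there. `ledger route dormant <id> --off` reactivates.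

# Route CardyAnchoredRigidity — tip-germ 0-1 law plus sector exhaustion make SLE6 locally rigid,
hence Cardy via the cluster-set lever

It suffices to show X = CardyShadowIsolated [local rigidity at the Cardy point, shadow form, SHARED
verbatim with route
CardyLocalRigidity, stmt-CriticalPhenomena-5767]: if the Cardy shadow g_F is a cluster point, as δ →
0⁺, of the
crossing-function path δ ↦ (R ↦ P_{1/2}[bond-ℤ² crossing of R at mesh δ]) in
[0,1]^{ConformalRectangle}, it is an
ISOLATED point of the cluster set; with the shared frame SubseqCardy + ClusterSetConnected (a
connected set with an
isolated member is that member) this is CardyFormulaZ2. This route is the ALTERNATIVE SECOND LAYER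
under X realising card
anchored-twists-germ-signed-drifts-2 (D-0019: alternative decomposition = separate route sharing the
decl): an impostor
limit accumulating at CLE₆ has a tangent at SLE₆, an infinitesimal counterexample inside 𝒞 =
{similarity+mirror
covariant, set-Markov, restriction-local, target-independent chordal families}; set-Markov makes it
a germ rule at the
marked point, the harmonics of the target direction u split it into a drift sector (killed by the
tip-germ 0-1 law
TipGermZeroOne + mirrors: Germ-Sign Lemma), odd sectors (no frame at a fractal tip) and a twist
sector (the target-anchored
Beltrami field c(z−b)/(z̄−b̄), killed by splitting: Anchoring Lemma); H¹_𝒞(SLE₆) = 0 plus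
linearisation gives X.
Lean: `∀ g : Literature.Probability.RandomPlanarGeometry.ConformalRectangle → ℝ, (∀ (R :
Literature.Probability.RandomPlanarGeometry.ConformalRectangle) (φ :
Literature.Probability.RandomPlanarGeometry.ConformalEquiv UpperHalfPlane.upperHalfPlaneSet
R.carrier) (x : Fin 4 → ℝ), R.IsUniformizing φ x → g R =
Literature.Probability.RandomPlanarGeometry.cardyFunction
(Literature.Probability.RandomPlanarGeometry.crossRatio x)) → MapClusterPt g (nhdsWithin (0 : ℝ)
(Set.Ioi 0)) (fun (δ : ℝ) (R : Literature.Probability.RandomPlanarGeometry.ConformalRectangle) =>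
Literature.Probability.Percolation.bondDomainCrossingProb R δ) → ∃ U ∈ nhds g, ∀ g' ∈ U,
MapClusterPt g' (nhdsWithin (0 : ℝ) (Set.Ioi 0)) (fun (δ : ℝ) (R :
Literature.Probability.RandomPlanarGeometry.ConformalRectangle) =>
Literature.Probability.Percolation.bondDomainCrossingProb R δ) → g' = g`

## Assembly
Pure point-set topology, no named facts; the deciding theorem `closes (hSub : SubseqCardy) (hConn :
ClusterSetConnected)
(hIso : CardyShadowIsolated) : CardyFormulaZ2` is the SAME sorry-free proof as CardyLocalRigidity's
(checked in the planner's
SketchGlue.lean): compactness of [0,1]^{ConformalRectangle} gives a cluster point along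
SubseqCardy's sequence, which is a
Cardy shadow; isolation + preconnectedness force the cluster set into {g}; a path in a compact set
with a unique cluster point
converges; coordinate projection = HasCrossingLimit. TipGermZeroOne and the supports feed
CardyShadowIsolated through the
informal second layer (SectorExhaustion, GermSignLemma, LinearisedRigidityIsolates), filed right
after open.

Rationale: WHY THIS LINE. Route CardyLocalRigidity poses local rigidity of SLE₆/CLE₆ (its informal crux
stmt-CriticalPhenomena-6806, H¹ = 0) with no
mechanism; this line supplies one, by INVERSION at first order (card
anchored-twists-germ-signed-drifts-2): the would-be
infinitesimal counterexample is asked what it is anchored to (set-Markov: the target b, the one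
point every remaining domain
shares) and what sign it carries (restriction-locality at κ = 6 is LSW's coordinate change dW̃ =
h′dW read forward,
LawlerSchrammWerner2001 Thm 2.2 / Cor 2.3–2.4, so a drift transforms by the POSITIVE factor h′(0)
and its sign is a germ
functional); the tip-germ 0-1 law freezes germ functionals along the process and mirror covariance
flips the sign, so the
absolutely continuous sector dies, while the tensor sector is the explicit target-centred
stretch/log-spiral family F_c
(measurable Riemann mapping, AstalaIwaniecMartin2008 Thm 5.3.2) that satisfies every axiom except
splitting — percolation
explorations do not know their target. Imported areas: deformation/rigidity theory of SLE (LSW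
locality calculus,
SchrammWilson2005, Werner2004Girsanov; Beffara2008Universal Prop 4 shears as the
translation-anchored cousin; the massive
drift of GarbanPeteSchramm2018 as the known drift element), fine structure of the SLE tip
(RohdeSchramm2005 — PROVED in tree,
hasSLETrace_of_ne_eight_holds; Blumenthal 0-1 for the time-reversed driver,
isPreBrownianReal_reverseAt; tip multifractality
doi:10.1007/s11511-012-0087-1, DuplantierBinder2002, arXiv:1504.05570), and the cluster-set topology
of CardyLocalRigidity
(Hale2010, SchrammSmirnov2011). What it does that prior routes do not: it decomposes the deformation
space of the exploration
LAW and pins each clause of stmt-0698/6806 to the sector it alone kills (targetIndependent ↔ twists;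
the SET clause of the
Markov extension + mirrors ↔ drifts), and it files the one SLE theorem (TipGermZeroOne) on which the
drift half rests.

RANKED CRUXES. #2 TipGermZeroOne (crux) — TIP-GERM 0-1 LAW (card K2, half-plane form): for chordal
SLE₆ in ℍ (driving √6·B on the pre-Wiener space) and every capacity time t > 0, every
germ-determined event of the hull recentred at the tip — a family A of subsets of ℂ whose membership
depends, for EVERY r > 0, only on K ∩ B(0, r) — evaluated at K = K_t − γ(t), the Loewner hull and
trace at time t of the driver s ↦ √6·B_s (rev 2: stated over Loewner.hull/Loewner.trace + brownian,
= sleHull 6 ω t − sleTrace 6 ω t by rfl, see DEFINITION REQUESTS · CONE) (null-measurability w.r.t.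
the pre-Wiener measure assumed, so completed events count) has probability 0 or 1 (no rotational
normalisation, no scale invariance assumed; orientation-dependent germ functionals are thus a.s.
constant). [difficulty: L] (why it might fail: If the tip kept an orientation memory across scales
(bounded winding variance of arg f_t′ near W_t), cone-avoidance events {K misses a sector at 0}
would have probability strictly between 0 and 1; only rotation-invariant germ events are
Blumenthal-trivial for free.) [RohdeSchramm2005, doi:10.1007/s11511-012-0087-1,
DuplantierBinder2002, arXiv:1504.05570, Sheffield2016, Lawler2005]
#5 CardyShadowIsolated (crux) — X itself, shared verbatim with CardyLocalRigidity
(stmt-CriticalPhenomena-5767): the Cardy shadow, if a cluster point at 0⁺ of the crossing-function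
path in the product space ConformalRectangle → ℝ, is an isolated point of the cluster set. In this
route it is the node decomposed by TipGermZeroOne + SectorExhaustion + LinearisedRigidityIsolates
(the latter two filed informally after open); it stays claimable directly. [deps: TipGermZeroOne]
[difficulty: open-problem] (why it might fail: Non-Cardy cluster points may accumulate at g_F
through a first-order direction the sector census misses: singular isotropic drifts on a chiral pair
of exceptional tip-germ times of hcap-dimension 1/2 (GPS2018 §13's second exponent pair) or an
exactly marginal duality-even scalar.) [GarbanPeteSchramm2018, LawlerSchrammWerner2001,
SchrammWilson2005, Werner2004Girsanov, Nolin2008]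
#6 SubseqCardy (crux) — frame, shared verbatim with CardyLocalRigidity
(stmt-CriticalPhenomena-5768): along ONE sequence of meshes δ_n → 0⁺, bondDomainCrossingProb R δ_n →
F(crossRatio x) for every conformal rectangle R and every uniformizing datum (φ, x) (makes the Cardy
shadow a cluster point; expected from the symmetry-upgrade routes run along a subsequence).
[difficulty: open-problem] (why it might fail: Identifying even one subsequential limit with Cardy
for ALL rectangles needs dilation covariance of a ℤ² subsequential limit (rotations: DKKMO Thm 1.4;
dilations open) and no ℤ² holomorphic observable exists (Smirnov's is 𝕋-only).) [SchrammSmirnov2011,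
CamiaNewman2007, DKKMO2020Rotational, Smirnov2001, KemppainenSmirnov2017]
#7 ClusterSetConnected (crux) — frame, shared verbatim with CardyLocalRigidity
(stmt-CriticalPhenomena-5769): the cluster set at 0⁺ of δ ↦ (R ↦ bondDomainCrossingProb R δ) is
preconnected in the product space (asymptotic continuity in log δ + Hale's ω-limit lemma).
[difficulty: L] (why it might fail: Needs o(1) variation of p_R(δ) under δ ↦ (1+o(1))δ for EVERY
Jordan rectangle incl. wild boundaries at the marks under G02's largest-component discretisation
(near-miss / half-plane 3-arm bounds); that uniformity is unwritten.) [SchrammSmirnov2011,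
GarbanPeteSchramm2013Pivotal, Hale2010, GrimmettPercolation1999]
#9 AnchoringClassification (support) — the m = 2 harmonic classification behind the Anchoring Lemma
(card P1(i)): a field N : ℂ → ℂ with N(λe^{iθ}w) = e^{2iθ}N(w) for all λ > 0, θ ∈ ℝ, w ≠ 0 is N(w) =
N(1)·w/w̄ — the target-anchored Beltrami field c(z−b)/(z̄−b̄) is the only structure deformation
sourced by the target direction. Proved sorry-free in the planner's Sketch.lean
(anchoringClassification_holds, 15 lines; copy it). [difficulty: provable-now]
[AstalaIwaniecMartin2008, Beffara2008Universal]
#9 AnchoredPullbackAxioms (support) — ANCHORING LEMMA, positive half (card P1(iii)/P3): pull a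
chordal family S back along a target-anchored field of plane homeomorphisms b ↦ Φ_b (Φ_b fixes b;
similarities conjugate Φ_{mb+w} to Φ_b up to a similarity; conjugation intertwines Φ_{b̄} and Φ_b —
e.g. F_{c,b}(z) = b + (z−b)|z−b|^{2c/(1−c)}, c real), P D := (Φ_{D.pt 1})⁻¹_* S(Φ_{D.pt 1} D). If S
is chordal, similarity covariant, mirror covariant, set-Markov (IsDomainMarkov), restriction-local
(IsLocal) and traces no boundary arc, so is P — every clause of stmt-0698/6806 except target
independence survives anchoring at the target (one map per target b; the SET clause of
IsMarkovExtension is respected because remaining domains keep b). Representative independence of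
stopAt/startFrom on ℂ (the named facts CurveClass.stopAt_mk/startFrom_mk) is INLINED as a
hypothesis. [difficulty: L] [LawlerSchrammWerner2001, Werner2007, AstalaIwaniecMartin2008,
Beffara2008Universal]

TWO-LAYER PLAN. Filed informally right after open (no Lean notion of a tangent vector to the space
of chordal families yet — definition
request D1): SectorExhaustion (rank 3, card K1: every first-order deformation of the SLE₆ chordal
family inside 𝒞 is a sum of
the isotropic-drift, diffusivity and target-axis-twist sectors, odd harmonics absent),
LinearisedRigidityIsolates (rank 4,
card K3: H¹_𝒞(SLE₆) = 0 ∧ non-degenerate normalised blow-up of impostors ⇒ CardyShadowIsolated,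
through CardyLocalRigidity's
IdentificationGlue), GermSignLemma (support, card P2: TipGermZeroOne + mirror covariance + dW̃ =
h′dW ⇒ the absolutely
continuous sector vanishes and κ̇ = 0 by (κ/2−3)h″), StretchedPullbackNotTargetBlind (support, card
P3 negative half: for
S = the SLE₆ family and Φ_b = F_{c,b}, c ≠ 0 real, the pullback family of AnchoredPullbackAxioms is
NOT IsTargetIndependent and
differs from S). Foreseen glued split once D1 lands: CardyShadowIsolated ⇐ H1Vanishes →
LinearisedRigidityIsolates →
CardyShadowIsolated with H1Vanishes ⇐ TipGermZeroOne ∧ SectorExhaustion ∧ GermSignLemma (k ≤ 3,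
depth 1).

KILL CRITERIA. ¬TipGermZeroOne (an orientation memory of the SLE₆ tip: a germ event of intermediate
probability) kills the Germ-Sign Lemma and
names the surviving sector (germ-signed chiral drifts) — close `refuted:TipGermZeroOne` unless
SectorExhaustion absorbs that
sector with an independent killer. A first-order deformation of the SLE₆ chordal family inside 𝒞
outside the three named sectors
(candidate: dW = √6 dB + ε(dL⁺ − dL⁻) on a chiral pair of exceptional tip-germ classes of
hcap-dimension exactly 1/2) refutes
SectorExhaustion and the line (close; hand the class to card logperiodic-limitexists-hunt as an
impostor seed).
¬CardyShadowIsolated given SubseqCardy ∧ ClusterSetConnected is ¬CardyFormulaZ2 (kills every route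
of the conjunct).
¬ClusterSetConnected / ¬SubseqCardy by a wild-boundary discretisation artefact is reported to the
operator as for
CardyUniqueLimit.NegDegenerateArcs, not a pivot. CardyShadowIsolated proved directly
(CardyLocalRigidity) or SLE6LimitZ2 proved
moots the route; a refutation of AnchoredPullbackAxioms would only be a typing defect of the
anchoring hypotheses (repair, not close).

NOT DECOMPOSED YET. The tangent space itself (D1 TangentAtSLE6: first-order deformations as families
of linear functionals on smooth cylinder
test functions of stopped curves, with the linearised
similarity/mirror/set-Markov/IsLocal/IsTargetIndependent clauses — the
critic's flag that Beltrami, Cameron–Martin and singular sectors live in different spaces is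
answered there, not here); the
existence-of-tangent-law clause of card K2 (only the 0-1 law is filed); the isometry-only class of
stmt-6806 (massive drift,
KS-uniformity) — same proof sector by sector, later; the measure-level IdentificationGlue and D3
QuadCrossingSpace of
CardyLocalRigidity; the singular residual (local-time drifts on exceptional tip-germ times), which
is SectorExhaustion's own risk.

CHEAPEST FALSIFIER. Decide TipGermZeroOne's test event in SLE theory: does Var[arg f_t′(W_t + iy)] →
∞ as y ↓ 0 for chordal SLE₆ at a fixed
capacity time (tip spiralling ⇒ cone-avoidance germ events are trivial)? The backward-flow
representation makes
log f_t′ near the tip a functional of the time-reversed driver with diffusive argument (tip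
multifractal spectrum,
doi:10.1007/s11511-012-0087-1; mixed rotation spectrum DuplantierBinder2002; complex generalized
spectrum arXiv:1504.05570); a
BOUNDED winding variance would refute the crux at once. Ran by the card's author (kit j003362,
hexagonal explorer, half-plane,
T = 2·10⁴, N = 3000): winding variance of the past seen from the tip grows as 1.71·ln r with no
saturation up to r = 128 —
consistent with the crux. Second cheapest: check that F_{c,b} = b + (z−b)|z−b|^{2c/(1−c)} satisfies
the three anchoring
hypotheses of AnchoredPullbackAxioms literally (fixes b; similarity conjugation with m′ =
m|m|^{2c/(1−c)}; conjugation for c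
real) — done by hand this session, all three hold.

NUMBERS. κ = 6: LSW coordinate change dW̃ = h′dW + (κ/2 − 3)h″dt has no h″ term exactly at κ = 6
(LawlerSchrammWerner2001 Thm 2.2);
tip winding variance slope ≈ 1.71 per ln r in the toy run (card, kit j003362; 12/7 ≈ 1.714);
near-critical direction has
dimension 3/4 and is duality-odd (GarbanPeteSchramm2018 Cor 86); polychromatic 5-arm exponent 2,
half-plane 3-arm exponent 2
(SmirnovWerner2001, Nolin2008). Items at open: 7 (4 cruxes incl. 3 shared, 2 supports, 1 assembly);
filed right after open:
2 informal cruxes (ranks 3, 4), 2 informal supports, 1 definition request.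

DEFINITION REQUESTS. D1 `TangentAtSLE6` (topic Summits/CriticalPhenomena/CardyFormulaZ2/Theorems — a
posited object of this problem): a first-order
deformation of the chordal SLE₆ family P⁰ inside a class 𝒞 of chordal families = a family Ṗ_D of
linear functionals on smooth
cylinder functions of curves stopped at exits of balls, arising as ε-derivatives at 0 of C¹ curves ε
↦ P^ε in 𝒞 with P⁰ = SLE₆,
together with the linearised clauses of IsSimilarityCovariant, mirror covariance, IsMarkovExtension
(a)–(c), IsLocal,
IsTargetIndependent; sectors = the subspaces generated by Beltrami fields (twists), adapted
drifts/diffusivities of the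
driver (Cameron–Martin), and singular finite-variation perturbations. Serves SectorExhaustion and
GermSignLemma. No cite
facts wanted: Rohde–Schramm (hasSLETrace_of_ne_eight_holds) and BM time reversal
(isPreBrownianReal_reverseAt) are PROVED in tree.
Cone repair (2026-08-15, rev 2–3; guardrail listed 16 unproved named facts in the route file's
IMPORT cone). needs-fact: NONE. (i) Route-authored imports are now LoewnerChain + BrownianMotion +
ChordalCurveFamily (SLE.lean dropped: TipGermZeroOne restated 1:1 over Loewner.hull/Loewner.trace of
s ↦ √6·B_s; planner Sketch.lean `restate_iff : New ↔ Filed := Iff.rfl`, lean check rc 0, axioms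
propext/Classical.choice/Quot.sound); these modules carry no unproved named fact, and after rev 2
the gate's constant cone reads `deps: 90 project constants, 0 unproved; staffable: true`. (ii) All
16 listed facts are STATEMENT-BORNE, i.e. they enter through the gate-rendered `import
Summits.CriticalPhenomena.Statement` (summit conjunction → the 4 sub Statements + CardyFormula.lean
[→ Isoradial: gm_boxCrossingBounds_uniform, gm_boxCrossing, gm_theta_critical_eq_zero,
gm_universality_arms, gm_universality_oneArm; CardyUniversality; CardyFormulaZ2 = this route's
TARGET, reached only as the conclusion of `closes`] + SelfAvoidingWalk.lean [→ SLE.lean: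
exists_isSLECurve, tendsto_norm_sleTrace_atTop, hasSLETrace_eight, HasSLETrace; SAWScalingLimit] +
CriticalContinuity.lean [PercolationContinuityZ3, FitznerVanDerHofstad2017_beta_eq_one] +
ScalingLimit3D.lean [CritIsing3DConformalLimit, CritIsing3DEuclideanLimit]); even the sub Statement
file Summits/CriticalPhenomena/CardyFormulaZ2/Statement.lean imports all four Literature statement
files; 4 of the 16 are the summit's own conjuncts and can never be discharged as debt. No item of
this route names any of them, as hypothesis or in a definiens. (iii) The κ = 6 instances of the four
SLE.lean facts that an SLE₆ line could want are THEOREMS of the tree: planner SLE6Inputs.lean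
`sle6_inputs_proved : HasSLETrace 6 ∧ (a.s. ‖sleTrace 6 ω t‖ → ∞) ∧ ∀ D : DobrushinDomain, ∃ Γ,
IsSLECurve 6 D Γ` from hasSLETrace_of_ne_eight_apply,
tendsto_norm_sleTrace_atTop_of_cor35_of_four_lt_of_lt_eight, RohdeSchramm2005_cor35_holds,
exists_isSLECurve_at (lean check rc 0, axioms clean) — so layer 2 (LinearisedRigidityIsolates,
GermSignLemma, StretchedPullbackNotTargetBlind: 'the chordal SLE₆ family') rests on proved facts,
not on exists_isSLECurve (all κ, blocked at κ = 8). (iv) OPERATOR HYGIENE, outside planner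
authority, that empties the module cone of this route (and of every ℤ²-Cardy route): O1 render route
files with `import Summits.CriticalPhenomena.CardyFormulaZ2.Statement` (the by-name target needs
only the sub Statement); O2 trim that sub Statement file to `import
Literature.Probability.Percolation.CardyFormula`; O3 move the isoradial section crit-perc.S23
(CardyUniversality, embDomainCrossing) together with the Isoradial / IsoradialPercolation imports
that only it uses out of Literature/Probability/Percolation/CardyFormula.lean (then gm_* ×5 and
CardyUniversality leave the cone of every ℤ²-Cardy route; bondDomainCrossingProb,
triDomainCrossingProb, CardyFormulaZ2 and the Smirnov-side statements stay); O4 the module-cone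
guardrail should not count a route's own @[summit_statement] target (`#h21_route_deps` already marks
it via_statement_only).

Novelty: Searches (2026-08-15): `lit galaxy search "multifractal spectrum for the tip" --star all` (4 pdf
rows: arXiv:1412.8764,
arXiv:2211.15609, arXiv:1504.05570, arXiv:1910.05519); `lit galaxy search --star pdf --mode bm25
"first-order deformations /
Beltrami perturbations of SLE or CLE laws … rigidity of SLE_6 among Markov local families without
conformal invariance"` (20
rows: Werner math/0307353, Rohde 1007.2007, Smirnov ICM, Dubédat math/0507276, Peltola 2024,
Gruzberg — none deforms the law
inside an axiom class or anchors a structure at the target); `lit search --source arxiv "Doyon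
conformal loop ensembles
stress-energy tensor"` (4: arXiv:1209.1560, 0908.1511, 0903.0372, 1209.4860 — conformal DERIVATIVES
of CLE under domain
variations, conformal invariance assumed); `lit search --source arxiv` for the tip spectrum
(arXiv:0911.3983) and the
generalized integral means spectrum (arXiv:1504.05570, 2206.09192, 2203.10782, 1211.2451); `lit
search --source crossref
"winding harmonic measure SLE mixed multifractal spectrum"` (8: doi:10.1007/s11511-012-0087-1,
doi:10.1103/physrevlett.89.264101,
doi:10.1007/s00220-009-0864-7, doi:10.1007/s00440-020-00975-w); `lit frontier CriticalPhenomena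
--since 2022` (30 rows, none on
first-order rigidity of ℤ² subsequential limits); `ledger negatives --problem CriticalPhenomena` (6,
none touching these
statements; stmt-0748's refutation certifies the frame is not junk-refutable by degenerate arcs);
in-tree: all 45 Theses files
of the sub grepped f  [refs: 10.1007/s11511-012-0087-1, 10.1103/physrevlett.89.264101, 10.1007/s00220-009-0864-7, 10.1007/s00440-020-00975-w, 1412.8764, 2211.15609, 1504.05570, 1910.05519, 1209.1560, 0911.3983, math/9911084, 0708.3908, doi:10.1007/s11511-012-0087-1, doi:10.1103/physrevlett.89.264101, doi:10.1007/s00220-009-0864-7, doi:10.1007/s00440-020-00975-w, LawlerSchrammWerner2001, GarbanPeteSchramm2018, DuplantierBinder]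

Barriers (technique_class: deformation-rigidity, beltrami-anchor, germ-zero-one): - technique_class: deformation-rigidity, beltrami-anchor, germ-zero-one
- Literature.Barriers.CriticalPhenomena.EmbeddingModulusUniqueness: USED at an identified line, not
evaded wholesale — every frame item is stated for the ℤ² embedding (bondDomainCrossingProb) and the
rigidity class 𝒞 carries rotation AND mirror covariance, which the sheared embeddings diag(1,p)ℤ²
lack; rotation covariance (DKKMO, the barrier's evasion (i)) is consumed exactly in the Anchoring
Lemma, where it removes the constant part N ≡ c₀ of the anchored field (Beffara's shear, invisible
to splitting since stretched lattices are target-free); the Germ-Sign Lemma uses only shared inputs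
and accordingly kills a sector without proving invariance; for diag(1,p)ℤ² the scheme yields
nothing, as it must.
- Literature.Barriers.CriticalPhenomena.ScaleCovarianceNotMoebius: catalogued for
Ising3DConformalLimit; its planar moral is respected — no upgrade from symmetry data alone: the
structural inputs are set-Markov, restriction-locality and splitting, each matched to the
counterexample it kills (GarbanPeteSchramm2018's near-critical limits are the percolation witness
that Euclidean + Markov + local do not suffice; mirrors and scale-uniform RSW exclude them).
- Literature.Barriers.CriticalPhenomena.SmirnovTriangularOnly: not in class — no
discrete-holomorphic observable, no colour switching.
- Literature.Barriers.CriticalPhenomena.FKParafermionicHalfCauchyRiemann: not in class — no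
parafermionic observable or verte

History (route lifecycle, newest last):
- 2026-08-15T19:44:34Z · rev 2: restated TipGermZeroOne (stmt-CriticalPhenomena-12842) — cone repair (rrepair g2): TipGermZeroOne restated 1:1 over Loewner.hull/Loewner.trace of s ↦ √6·B_s (defeq: Sketch.lean restate_iff := Iff.rfl, rc 0); imports S (planner-rrepair-CriticalPhenomena-CardyAnchore-ddae6834-g2-0)
- 2026-08-25T14:49:06Z · DORMANT — reconciler: no traction for 7.8 d (last activity item-evidence-added at 2026-08-17T19:17:51Z); parked, not closed — `ledger route dormant route-CriticalPhenomen (operator:999:2628546)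

sub-problem: CardyFormulaZ2 · status: dormant · opened planner-plancard-CriticalPhenomena-CardyFormu-266c3064-0 2026-08-15T18:59:11Z · rev 3 · ledger route-CriticalPhenomena-CardyAnchoredRigidity
GENERATED by the gate from the ledger (D-0016/17). Provers cite these decls: `theorem foo : Summit.CriticalPhenomena.CardyFormulaZ2.Theses.CardyAnchoredRigidity.<Decl> := …` in Summits/CriticalPhenomena/CardyFormulaZ2/Theorems/<Name>.lean.
-/

namespace Summit.CriticalPhenomena.CardyFormulaZ2.Theses.CardyAnchoredRigidity

open scoped BigOperators Topology Manifold Classical MeasureTheory ProbabilityTheory Matrix InnerProductSpace ComplexConjugate ContinuousMap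
open Filter Set Function TopologicalSpace MeasureTheory

attribute [summit_statement] _root_.CardyFormulaZ2

-- earlier TipGermZeroOne (stmt-CriticalPhenomena-12842, replaced 2026-08-15T19:44:34Z -> stmt-CriticalPhenomena-13614): retired by None — ∀ (t : NNReal), 0 < t → ∀ A : Set (Set ℂ), (∀ r : ℝ, 0 < r → ∀ K K' : Set ℂ, K ∩ Metric.ball (0 : ℂ) r = K' ∩ Metric.ball (0 : ℂ) r → (K ∈ A ↔ K' ∈ A)) → MeasureTheory.NullMeasurableSet {ω : NNReal → ℝ | (fun z : ℂ => z - Literature.Probability.RandomPlanarGeometr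
/-- item stmt-CriticalPhenomena-13614 · crux · rank 2 · open · by planner
why it might fail: If the tip kept an orientation memory across scales (bounded winding variance of arg f_t′ near W_t), cone-avoidance events {K misses a sector at 0} would have probability strictly between 0 and 1; only rotation-invariant germ events are Blumenthal-trivial for free.
sources: RohdeSchramm2005, doi:10.1007/s11511-012-0087-1, DuplantierBinder2002, arXiv:1504.05570, Sheffield2016, Lawler2005
[crux] TIP-GERM 0-1 LAW (card anchored-twists-germ-signed-drifts-2, K2; half-plane form): for
chordal SLE₆ in ℍ — the Loewner chain driven by W_s = √6·B_s on the pre-Wiener space (Loewner.hull /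
Loewner.trace of s ↦ √6·brownian s ω) — and every capacity time t > 0, every germ-determined event
of the hull recentred at the tip — a family A of subsets of ℂ whose membership depends, for EVERY r
> 0, only on K ∩ B(0, r) — evaluated at K = K_t − γ(t) (null-measurability w.r.t. the pre-Wiener
measure assumed, so completed events count) has probability 0 or 1 (no rotational normalisation, no
scale invariance assumed; orientation-dependent germ functionals are thus a.s. constant). CONE
REPAIR 2026-08-15: this is the rev-1 statement VERBATIM up to unfolding sleHull 6 ω t = Loewner.hull
(sleDriving 6 ω) t, sleTrace 6 ω = Loewner.trace (sleDriving 6 ω), sleDriving 6 ω s = √6·brownian s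
ω (all rfl; planner Sketch.lean `restate_iff : New ↔ Filed := Iff.rfl`, lean check rc 0, axioms
propext/Classical.choice/Quot.sound), so the route imports LoewnerChain + BrownianMotion instead of
SLE.lean, whose unproved all-κ facts (exists_isSLECurve, tendsto_norm_sleTrace_atTop,
hasSLETrace_eight, HasSLETrace) -/
@[route_item "route-CriticalPhenomena-CardyAnchoredRigidity"]
def TipGermZeroOne : Prop :=
  ∀ (t : NNReal), 0 < t → ∀ A : Set (Set ℂ), (∀ r : ℝ, 0 < r → ∀ K K' : Set ℂ, K ∩ Metric.ball (0 : ℂ) r = K' ∩ Metric.ball (0 : ℂ) r → (K ∈ A ↔ K' ∈ A)) → MeasureTheory.NullMeasurableSet {ω : NNReal → ℝ | (fun z : ℂ => z - Literature.Probability.RandomPlanarGeometry.Loewner.trace (fun s : NNReal => Real.sqrt ((6 : NNReal) : ℝ) * Literature.Probability.Process.brownian s ω) t) '' Literature.Probability.RandomPlanarGeometry.Loewner.hull (fun s : NNReal => Real.sqrt ((6 : NNReal) : ℝ) * Literature.Probability.Process.brownian s ω) t ∈ A} Literature.Probability.Process.preWienerMeasure → Literature.Probability.Process.preWienerMeasure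 {ω : NNReal → ℝ | (fun z : ℂ => z - Literature.Probability.RandomPlanarGeometry.Loewner.trace (fun s : NNReal => Real.sqrt ((6 : NNReal) : ℝ) * Literature.Probability.Process.brownian s ω) t) '' Literature.Probability.RandomPlanarGeometry.Loewner.hull (fun s : NNReal => Real.sqrt ((6 : NNReal) : ℝ) * Literature.Probability.Process.brownian s ω) t ∈ A} = 0 ∨ Literature.Probability.Process.preWienerMeasure {ω : NNReal → ℝ | (fun z : ℂ => z - Literature.Probability.RandomPlanarGeometry.Loewner.trace (fun s : NNReal => Real.sqrt ((6 : NNReal) : ℝ) * Literature.Probability.Process.brownian s ω) t) '' Literature.Probability.RandomPlanarGeometry.Loewner.hull (fun s : NNReal => Real.sqrt ((6 : NNReal) : ℝ) * Literature.Probability.Process.brownian s ω) t ∈ A}ᶜ = 0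

/-- item stmt-CriticalPhenomena-5767 · crux · rank 5 · open · by planner
why it might fail: Non-Cardy cluster points may accumulate at g_F through a first-order direction the sector census misses: singular isotropic drifts on a chiral pair of exceptional tip-germ times of hcap-dimension 1/2 (GPS2018 §13's second exponent pair) or an exactly marginal duality-even scalar.
sources: GarbanPeteSchramm2018, LawlerSchrammWerner2001, SchrammWilson2005, Werner2004Girsanov, Nolin2008
[crux] local uniqueness at the Cardy point (card T3, shadow form): if the Cardy shadow g (g R =
F(crossRatio x) for every uniformizing datum (φ, x) of R) is a cluster point, as δ → 0⁺, of the path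
δ ↦ (R ↦ bondDomainCrossingProb R δ) in the product space ConformalRectangle → ℝ, then it is an
ISOLATED point of the cluster set: some neighbourhood of g contains no other cluster point.
[difficulty: open-problem] -/
@[route_item "route-CriticalPhenomena-CardyAnchoredRigidity", crux]
def CardyShadowIsolated : Prop :=
  ∀ g : Literature.Probability.RandomPlanarGeometry.ConformalRectangle → ℝ, (∀ (R : Literature.Probability.RandomPlanarGeometry.ConformalRectangle) (φ : Literature.Probability.RandomPlanarGeometry.ConformalEquiv UpperHalfPlane.upperHalfPlaneSet R.carrier) (x : Fin 4 → ℝ), R.IsUniformizing φ x → g R = Literature.Probability.RandomPlanarGeometry.cardyFunction (Literature.Probability.RandomPlanarGeometry.crossRatio x)) → MapClusterPt g (nhdsWithin (0 : ℝ) (Set.Ioi 0)) (fun (δ : ℝ) (R : Literature.Probability.RandomPlanarGeometry.ConformalRectangle) => Literature.Probability.Percolation.bondDomainCrossingProb R δ) → ∃ U ∈ nhds g, ∀ g' ∈ U, MapClusterPt g' (nhdsWithin (0 : ℝ) (Set.Ioi 0)) (fun (δ : ℝ) (R : Literature.Probability.RandomPlanarGeometry.ConformalRectangle) => Literature.Probability.Percolation.bondDomainCrossingProb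 R δ) → g' = g

/-- item stmt-CriticalPhenomena-5768 · crux · rank 6 · open · by planner
why it might fail: Identifying even one subsequential limit with Cardy for ALL rectangles needs dilation covariance of a ℤ² subsequential limit (rotations: DKKMO Thm 1.4; dilations open) and no ℤ² holomorphic observable exists (Smirnov's is 𝕋-only).
sources: SchrammSmirnov2011, CamiaNewman2007, DKKMO2020Rotational, Smirnov2001, KemppainenSmirnov2017
[crux] Cardy along ONE sequence of meshes, for all conformal rectangles at once (card T4, imported):
there are δ_n → 0⁺ such that for every conformal rectangle R and every uniformizing datum (φ, x),
bondDomainCrossingProb R δ_n → F(crossRatio x). This makes the Cardy shadow a cluster point of the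
crossing-function path; it is the output expected from card scale-ergodic-quenched-upgrade or from
the symmetry-upgrade routes (CardyRotToConf, CardyViaSLE6) run along a subsequence
(Aizenman–Burchard tightness + DKKMO rotations + identification). [difficulty: open-problem] -/
@[route_item "route-CriticalPhenomena-CardyAnchoredRigidity", crux]
def SubseqCardy : Prop :=
  ∃ u : ℕ → ℝ, Filter.Tendsto u Filter.atTop (nhdsWithin (0 : ℝ) (Set.Ioi 0)) ∧ ∀ (R : Literature.Probability.RandomPlanarGeometry.ConformalRectangle) (φ : Literature.Probability.RandomPlanarGeometry.ConformalEquiv UpperHalfPlane.upperHalfPlaneSet R.carrier) (x : Fin 4 → ℝ), R.IsUniformizing φ x → Filter.Tendsto (fun n => Literature.Probability.Percolation.bondDomainCrossingProb R (u n)) Filter.atTop (nhds (Literature.Probability.RandomPlanarGeometry.cardyFunction (Literature.Probability.RandomPlanarGeometry.crossRatio x)))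

/-- item stmt-CriticalPhenomena-5769 · crux · rank 7 · closed · proved by Summit.CriticalPhenomena.CardyFormulaZ2.Theorems.ClusterSetConnected.clusterSetConnected @ 241f0b218bed (prover) · by planner
why it might fail: Needs o(1) variation of p_R(δ) under δ ↦ (1+o(1))δ for EVERY Jordan rectangle incl. wild boundaries at the marks under G02's largest-component discretisation (near-miss / half-plane 3-arm bounds); that uniformity is unwritten.
sources: SchrammSmirnov2011, GarbanPeteSchramm2013Pivotal, Hale2010, GrimmettPercolation1999
[crux] the cluster set Λ' = {g | g is a cluster point, as δ → 0⁺, of δ ↦ (R ↦ bondDomainCrossingProb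
R δ)} is (pre)connected in the product space ConformalRectangle → ℝ (card T1). Intended proof:
per-rectangle asymptotic continuity in log δ (support item ScaleContinuity) + the product-uniformity
form of "the ω-limit set of an asymptotically continuous precompact path is connected" (Hale2010
Lemma 3.1.1). [difficulty: L] -/
@[route_item "route-CriticalPhenomena-CardyAnchoredRigidity", crux]
def ClusterSetConnected : Prop :=
  IsPreconnected {g : Literature.Probability.RandomPlanarGeometry.ConformalRectangle → ℝ | MapClusterPt g (nhdsWithin (0 : ℝ) (Set.Ioi 0)) (fun (δ : ℝ) (R : Literature.Probability.RandomPlanarGeometry.ConformalRectangle) => Literature.Probability.Percolation.bondDomainCrossingProb R δ)}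

-- item stmt-CriticalPhenomena-14302 · support · rank 3 · open · by planner — informal only, no Lean statement yet:
--   [crux] SECTOR EXHAUSTION (card anchored-twists-germ-signed-drifts-2, K1; rank 3; informal until
--   definition request D1 TangentAtSLE6 lands). Every tangent vector at SLE₆ of a C¹ curve ε ↦ P^ε of
--   chordal families inside 𝒞 = {chordal, similarity + mirror covariant, set-Markov (IsDomainMarkov with
--   the SET clause (c) of IsMarkovExtension), restriction-local (IsLocal), target-independent
--   (IsTargetIndependent)} with P⁰ = the SLE₆ family is a sum of the three named sectors, each
--   satisfying the linearised axioms: (m=0) isotropic — an adapted drift / diffusivity perturbation of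
--   the √6·B driver whose ger

-- item stmt-CriticalPhenomena-14384 · support · rank 4 · open · by planner — informal only, no Lean statement yet:
--   [crux] LINEARISED RIGIDITY ISOLATES (card K3; rank 4; informal — measure-level objects pending, cf.
--   CardyLocalRigidity's IdentificationGlue and definition request D3 QuadCrossingSpace). If H¹_𝒞(SLE₆)
--   = 0 (no non-zero tangent vector in the sense of D1 TangentAtSLE6; = TipGermZeroOne ∧
--   SectorExhaustion ∧ GermSignLemma ∧ AnchoredPullbackAxioms-with-splitting) then CardyShadowIsolated:
--   (i) cluster functions g near the Cardy shadow g_F lift to chordal interface families in 𝒞 near SLE₆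
--   (Aizenman–Burchard tightness, DKKMO rotations, mirror = colour symmetry at p = 1/2,
--   set-Markov/locality/splitting e

/-- item stmt-CriticalPhenomena-12843 · support · rank 9 · closed · proved by Summit.CriticalPhenomena.CardyFormulaZ2.Theorems.anchoringClassification_proof @ 182f2fa03f12 (prover) · by planner
sources: AstalaIwaniecMartin2008, Beffara2008Universal
[support] the m = 2 harmonic classification behind the Anchoring Lemma (card P1(i)): a field N : ℂ →
ℂ with N(λe^{iθ}w) = e^{2iθ}N(w) for all λ > 0, θ ∈ ℝ, w ≠ 0 is N(w) = N(1)·w/w̄ — the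
target-anchored Beltrami field c(z−b)/(z̄−b̄) is the only structure deformation sourced by the
target direction. Proved sorry-free in the planner's Sketch.lean (anchoringClassification_holds, 15
lines; copy it). [difficulty: provable-now] -/
@[route_item "route-CriticalPhenomena-CardyAnchoredRigidity"]
def AnchoringClassification : Prop :=
  ∀ N : ℂ → ℂ, (∀ w : ℂ, w ≠ 0 → ∀ r θ : ℝ, 0 < r → N ((r : ℂ) * Complex.exp ((θ : ℂ) * Complex.I) * w) = Complex.exp (2 * (θ : ℂ) * Complex.I) * N w) → ∀ w : ℂ, w ≠ 0 → N w = N 1 * (w / (starRingEnd ℂ) w)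

/-- item stmt-CriticalPhenomena-12844 · support · rank 9 · closed · proved by Summit.CriticalPhenomena.CardyFormulaZ2.Theorems.anchoredPullbackAxioms_proof (prover) · by planner
sources: LawlerSchrammWerner2001, Werner2007, AstalaIwaniecMartin2008, Beffara2008Universal
[support] ANCHORING LEMMA, positive half (card P1(iii)/P3): pull a chordal family S back along a
target-anchored field of plane homeomorphisms b ↦ Φ_b (Φ_b fixes b; similarities conjugate Φ_{mb+w}
to Φ_b up to a similarity; conjugation intertwines Φ_{b̄} and Φ_b — e.g. F_{c,b}(z) = b +
(z−b)|z−b|^{2c/(1−c)}, c real), P D := (Φ_{D.pt 1})⁻¹_* S(Φ_{D.pt 1} D). If S is chordal, similarity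
covariant, mirror covariant, set-Markov (IsDomainMarkov), restriction-local (IsLocal) and traces no
boundary arc, so is P — every clause of stmt-0698/6806 except target independence survives anchoring
at the target (one map per target b; the SET clause of IsMarkovExtension is respected because
remaining domains keep b). Representative independence of stopAt/startFrom on ℂ (the named facts
CurveClass.stopAt_mk/startFrom_mk) is INLINED as a hypothesis. [difficulty: L] -/
@[route_item "route-CriticalPhenomena-CardyAnchoredRigidity"]
def AnchoredPullbackAxioms : Prop :=
  ∀ (S : Literature.Probability.RandomPlanarGeometry.ChordalFamily) (Φ : ℂ → ℂ ≃ₜ ℂ), (∀ b : ℂ, Φ b b = b) → (∀ (b m : ℂ) (hm : m ≠ 0) (w : ℂ), ∃ (m' : ℂ) (hm' : m' ≠ 0) (w' : ℂ), (Literature.Probability.RandomPlanarGeometry.similarity m hm w).trans (Φ (m * b + w)) = (Φ b).trans (Literature.Probability.RandomPlanarGeometry.similarity m' hm' w')) → (∀ b : ℂ, Complex.conjCLE.toHomeomorph.trans (Φ ((starRingEnd ℂ) b)) = (Φ b).trans Complex.conjCLE.toHomeomorph) → (∀ F : Set ℂ, IsClosed F → ∀ γ : Literature.Probability.RandomPlanarGeometry.Curve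 ℂ, Literature.Probability.RandomPlanarGeometry.CurveClass.stopAt F (Literature.Probability.RandomPlanarGeometry.CurveClass.mk γ) = Literature.Probability.RandomPlanarGeometry.CurveClass.mk (γ.stopAt F) ∧ Literature.Probability.RandomPlanarGeometry.CurveClass.startFrom F (Literature.Probability.RandomPlanarGeometry.CurveClass.mk γ) = Literature.Probability.RandomPlanarGeometry.CurveClass.mk (γ.startFrom F)) → S.IsChordal → S.IsSimilarityCovariant → (∀ D : Literature.Probability.RandomPlanarGeometry.DobrushinDomain, S (D.map Complex.conjCLE.toHomeomorph) = (S D).map (Literature.Probability.RandomPlanarGeometry.CurveClass.map (Complex.conjCLE.toHomeomorph : C(ℂ, ℂ)))) → S.IsDomainMarkov → S.IsLocal → (∀ D : Literature.Probability.RandomPlanarGeometry.DobrushinDomain, ∀ᵐ γ ∂(S D), ∀ c : Literature.Probability.RandomPlanarGeometry.Curve ℂ, Literature.Probability.RandomPlanarGeometry.CurveClass.mk c = γ → ∀ s t : unitInterval, s < t → c '' Set.Icc s t ⊆ frontier D.carrier → (c '' Set.Icc s t).Subsingleton) → ∀ P : Literature.Probability.RandomPlanarGeometry.ChordalFamily,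 (∀ D : Literature.Probability.RandomPlanarGeometry.DobrushinDomain, P D = (S (D.map (Φ (D.pt 1)))).map (Literature.Probability.RandomPlanarGeometry.CurveClass.map ((Φ (D.pt 1)).symm : C(ℂ, ℂ)))) → P.IsChordal ∧ P.IsSimilarityCovariant ∧ (∀ D : Literature.Probability.RandomPlanarGeometry.DobrushinDomain, P (D.map Complex.conjCLE.toHomeomorph) = (P D).map (Literature.Probability.RandomPlanarGeometry.CurveClass.map (Complex.conjCLE.toHomeomorph : C(ℂ, ℂ)))) ∧ P.IsDomainMarkov ∧ P.IsLocal ∧ (∀ D : Literature.Probability.RandomPlanarGeometry.DobrushinDomain, ∀ᵐ γ ∂(P D), ∀ c : Literature.Probability.RandomPlanarGeometry.Curve ℂ, Literature.Probability.RandomPlanarGeometry.CurveClass.mk c = γ → ∀ s t : unitInterval, s < t → c '' Set.Icc s t ⊆ frontier D.carrier → (c '' Set.Icc s t).Subsingleton)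

-- item stmt-CriticalPhenomena-14423 · support · rank 9 · open · by planner — informal only, no Lean statement yet:
--   [support] GERM-SIGN LEMMA (card P2; provable once D1 TangentAtSLE6 lands, from TipGermZeroOne). For
--   a tangent vector Ṗ at SLE₆ inside 𝒞: (a) at SLE₆ the remaining domain R_t = Ω∖K_t is a.s. Jordan
--   with γ(t), b on its boundary, so clauses (a)+(c) of IsMarkovExtension give Q D past = P(R_t; γ(t),
--   b) EXACTLY and the conditional first-order deformation of the near future at time t is the initial
--   deformation germ 𝔇(R_t, γ(t), b) (Ṗ on paths stopped on exiting small balls about the marked point);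
--   (b) IsLocal (restriction form) and IsTargetIndependent make 𝔇(R, x, b) depend only on (germ of R at
--   x, u

-- item stmt-CriticalPhenomena-14488 · support · rank 9 · open · by planner — informal only, no Lean statement yet:
--   [support] STRETCHED PULLBACK IS NOT TARGET-BLIND (card P3, negative half; the non-redundancy witness
--   for stmt-CriticalPhenomena-0698/6806). Let S be the chordal SLE₆ family (∀ D, IsSLELaw 6 D (S D)),
--   assumed conformally covariant, set-Markov, restriction-local, target-independent and non-tracing,
--   and let Φ_b = F_{c,b}, F_{c,b}(z) = b + (z − b)|z − b|^{2c/(1−c)} with c ∈ (0, 1/3) (a plane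
--   homeomorphism fixing b, Beltrami coefficient exactly c(z−b)/(z̄−b̄), satisfying the three anchoring
--   hypotheses of AnchoredPullbackAxioms). Then the pullback family P D := (F_{c,D.pt 1})⁻¹_*
--   S(F_{c,D.pt 1} D) —

/-- item stmt-CriticalPhenomena-5771 · assembly · rank 1 · closed · proved by Summit.CriticalPhenomena.CardyFormulaZ2.Theorems.cardyAnchoredRigidity_assembly_proof (prover) · by planner
sources: Hale2010, SchrammSmirnov2011
[assembly] SubseqCardy → ClusterSetConnected → CardyShadowIsolated → CardyFormulaZ2 (the
connectedness lever plus compactness of [0,1]^{ConformalRectangle}). -/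
@[route_item "route-CriticalPhenomena-CardyAnchoredRigidity"]
def Assembly : Prop :=
  SubseqCardy → ClusterSetConnected → CardyShadowIsolated → CardyFormulaZ2

/-! D-0027 §2.1 — DECIDING THEOREM (planner-authored via `route open/edit --closes-file`; by planner-plancard-CriticalPhenomena-CardyFormu-266c3064-0 2026-08-15T18:59:12Z):
its hypotheses are this route's items and its conclusion the sub-problem Statement (glue_lint), and it elaborates with this file. -/

@[closes "route-CriticalPhenomena-CardyAnchoredRigidity"] theorem closes (hSub : SubseqCardy) (hConn : ClusterSetConnected) (hIso : CardyShadowIsolated) :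
    _root_.CardyFormulaZ2 := by
  -- D-0027 §2.1 deciding theorem of route CardyAnchoredRigidity. The frame (SubseqCardy,
  -- ClusterSetConnected, CardyShadowIsolated) is shared verbatim with route CardyLocalRigidity
  -- (stmt-CriticalPhenomena-5768/5769/5767); this route is the alternative second layer under
  -- CardyShadowIsolated (tip-germ 0-1 law + sector exhaustion). Pure point-set topology, no
  -- named Literature fact.
  -- (0) every crossing function lives in the compact box [0,1]^ConformalRectangle (Tychonoff)
  have hK : IsCompact (Set.pi Set.univ
      (fun _ : Literature.Probability.RandomPlanarGeometry.ConformalRectangle => Set.Icc (0 : ℝ) 1)) :=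
    isCompact_univ_pi fun _ => isCompact_Icc
  have hPK : ∀ δ : ℝ,
      (fun R : Literature.Probability.RandomPlanarGeometry.ConformalRectangle =>
          Literature.Probability.Percolation.bondDomainCrossingProb R δ) ∈
        Set.pi Set.univ
          (fun _ : Literature.Probability.RandomPlanarGeometry.ConformalRectangle =>
            Set.Icc (0 : ℝ) 1) :=
    fun δ => Set.mem_univ_pi.2 fun R =>
      Literature.Probability.Percolation.bondDomainCrossingProb_mem_Icc R δ
  -- (1) SubseqCardy: a sequence of meshes u n → 0⁺ along which Cardy holds for every datum;
  --     the sequence of crossing functions has a cluster point g in the compact box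
  obtain ⟨u, hu, hlim⟩ := hSub
  obtain ⟨g, -, hg⟩ := hK.exists_mapClusterPt_of_frequently (l := Filter.atTop)
    (f := fun (n : ℕ) (R : Literature.Probability.RandomPlanarGeometry.ConformalRectangle) =>
      Literature.Probability.Percolation.bondDomainCrossingProb R (u n))
    (Filter.Eventually.of_forall fun n => hPK (u n)).frequently
  -- g is a cluster point of the crossing-function path along 𝓝[>] 0 (map u atTop ≤ 𝓝[>] 0)
  have hgL : MapClusterPt g (nhdsWithin (0 : ℝ) (Set.Ioi 0))
      (fun (δ : ℝ) (R : Literature.Probability.RandomPlanarGeometry.ConformalRectangle) =>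
        Literature.Probability.Percolation.bondDomainCrossingProb R δ) :=
    MapClusterPt.of_comp hu hg
  -- g is a Cardy shadow
  have hshadow : ∀ (R : Literature.Probability.RandomPlanarGeometry.ConformalRectangle)
      (φ : Literature.Probability.RandomPlanarGeometry.ConformalEquiv
        UpperHalfPlane.upperHalfPlaneSet R.carrier)
      (x : Fin 4 → ℝ), R.IsUniformizing φ x →
        g R = Literature.Probability.RandomPlanarGeometry.cardyFunction
          (Literature.Probability.RandomPlanarGeometry.crossRatio x) := by
    intro R φ x hux
    have h1 : MapClusterPt (g R) Filter.atTop
        (fun n : ℕ => Literature.Probability.Percolation.bondDomainCrossingProb R (u n)) :=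
      hg.continuousAt_comp (continuous_apply R).continuousAt
    have h2 : Filter.map
        (fun n : ℕ => Literature.Probability.Percolation.bondDomainCrossingProb R (u n))
          Filter.atTop ≤
        nhds (Literature.Probability.RandomPlanarGeometry.cardyFunction
          (Literature.Probability.RandomPlanarGeometry.crossRatio x)) :=
      hlim R φ x hux
    exact eq_of_nhds_neBot (h1.clusterPt.mono h2).neBot
  -- (2) CardyShadowIsolated + ClusterSetConnected force the cluster set into {g}
  obtain ⟨U, hU, hUiso⟩ := hIso g hshadow hgL
  have hΛ : IsPreconnected
      {g' : Literature.Probability.RandomPlanarGeometry.ConformalRectangle → ℝ |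
        MapClusterPt g' (nhdsWithin (0 : ℝ) (Set.Ioi 0))
          (fun (δ : ℝ) (R : Literature.Probability.RandomPlanarGeometry.ConformalRectangle) =>
            Literature.Probability.Percolation.bondDomainCrossingProb R δ)} :=
    hConn
  have hgint : g ∈ interior U := mem_interior_iff_mem_nhds.2 hU
  have hcover : ∀ h : Literature.Probability.RandomPlanarGeometry.ConformalRectangle → ℝ,
      h ∈ interior U ∪
        ({g} : Set (Literature.Probability.RandomPlanarGeometry.ConformalRectangle → ℝ))ᶜ := by
    intro h
    by_cases e : h = g
    · rw [e]
      exact Set.mem_union_left _ hgint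
    · exact Set.mem_union_right _ (Set.mem_compl_singleton_iff.2 e)
  have huniq : ∀ g' : Literature.Probability.RandomPlanarGeometry.ConformalRectangle → ℝ,
      MapClusterPt g' (nhdsWithin (0 : ℝ) (Set.Ioi 0))
        (fun (δ : ℝ) (R : Literature.Probability.RandomPlanarGeometry.ConformalRectangle) =>
          Literature.Probability.Percolation.bondDomainCrossingProb R δ) → g' = g := by
    intro g' hg'
    by_contra hne
    obtain ⟨h, hhΛ, hhU, hhg⟩ := hΛ (interior U)
      ({g} : Set (Literature.Probability.RandomPlanarGeometry.ConformalRectangle → ℝ))ᶜ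
      isOpen_interior isOpen_compl_singleton (fun h _ => hcover h)
      ⟨g, hgL, hgint⟩ ⟨g', hg', Set.mem_compl_singleton_iff.2 hne⟩
    exact (Set.mem_compl_singleton_iff.1 hhg) (hUiso h (interior_subset hhU) hhΛ)
  -- (3) a path with values in a compact set and a unique cluster point there converges
  have htend : Filter.Tendsto
      (fun (δ : ℝ) (R : Literature.Probability.RandomPlanarGeometry.ConformalRectangle) =>
        Literature.Probability.Percolation.bondDomainCrossingProb R δ)
      (nhdsWithin (0 : ℝ) (Set.Ioi 0)) (nhds g) :=
    hK.tendsto_nhds_of_unique_mapClusterPt (Filter.Eventually.of_forall hPK)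
      fun g' _ hg' => huniq g' hg'
  -- (4) coordinate projection + the shadow identity = `R.HasCrossingLimit`, i.e. CardyFormulaZ2
  intro R φ x hux
  have hR := tendsto_pi_nhds.1 htend R
  rw [hshadow R φ x hux] at hR
  exact hR

end Summit.CriticalPhenomena.CardyFormulaZ2.Theses.CardyAnchoredRigidity
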